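import Summits.AtomisticToContinuum.FouriersLaw.Theorems.BondHeatUncertaintySubdiffusiveBondHeatJunctionRatioTemperedPairing
import Summits.AtomisticToContinuum.FouriersLaw.Theorems.BondHeatUncertaintySubdiffusiveBondHeatJunctionRatioBracketCalculus

/-!
# `JunctionRatioGibbsAdjoint` — file 23c of the junction-ratio programme: the `μ_T`-adjoint
# identity for the Langevin generator on the tempered class

Route `BondHeatUncertainty`, residual `BoundedResponse` (stmt-AtomisticToContinuum-11071), leaf [BI]
`EscapeGrading.FirstBondBracket` (19b), g64 weak-form skeleton, pieces **[GIBBS] (G1b)**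
`⟨p_b Ψ⟩_T = T` and the Gibbs half of **[WL]**: both are special cases of ONE identity for
`P = pinnedChain ω₂ lam β γ` (`ω₂ > 0`, `lam, β ≥ 0`, `T > 0`, `ρ_T = e^{-H/T}`, `L = L_{T,T}`),
valid for `F ∈ C²`, `G ∈ C¹` with `F, G` and the occurring partials TEMPERED (23a):
`∫ G (L F) ρ_T = - ∫ (X_H G) F ρ_T - γ T Σ_i w_i ∫ ∂_{p_i}G ∂_{p_i}F ρ_T`,
`X_H G = Σ_i (p_i ∂_{q_i}G - ∂_{q_i}H ∂_{p_i}G)`, `w = bathWeight` (§D; §B: the Liouville pairing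
is `μ_T`-antisymmetric, from 23a (IBP-q) on `p_i G F` and (IBP-p) on `∂_{q_i}H G F`; §C: each
thermostat is `μ_T`-symmetric with form `-T ∫ ∂_{p_c}G ∂_{p_c}F ρ_T`, from (IBP-p) on
`G ∂_{p_c}F`). §E: (ADJ-p) `∫ p_b (L F) ρ_T = ∫ ∂_{q_b}H F ρ_T - γ w_b ∫ p_b F ρ_T` (the `q`-side
case (ADJ-q), `G = g(q)`, is derived where it is used, file 23d). No definitions; all theorems fully
proved; imports 23a and 22a (landed).
-/

noncomputable section

open MeasureTheory Filter Topology Set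
open scoped BigOperators ContDiff

namespace Summit.AtomisticToContinuum.FouriersLaw.Theorems.SubdiffusiveBondHeat

namespace EscapeGrading

open Literature.MathematicalPhysics.KineticTheory.HeatConduction
open Summit.AtomisticToContinuum.FouriersLaw.Cruxes.SuperadditiveResistance.InsertionToolbox
  (partialP_snd partialQ_snd)

variable {N : ℕ} {ω₂ lam β γ : ℝ}

/-! ## A. A line-derivative rule -/

/-- `∂_v (c · F · G) = c (∂_v F · G + F · ∂_v G)` when the factor `c` is constant along `v` (product
rule; cf. `ThomsonBound.hasLineDerivAt_mul` / `hasLineDerivAt_const_weight_mul`). -/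
theorem hasLineDerivAt_mul_mul_of_invariant {c F G : PhaseSpace N → ℝ} {F' G' : ℝ}
    {x v : PhaseSpace N} (hc : ∀ t : ℝ, c (x + t • v) = c x) (hF : HasLineDerivAt ℝ F F' x v)
    (hG : HasLineDerivAt ℝ G G' x v) :
    HasLineDerivAt ℝ (fun y => c y * (F y * G y)) (c x * (F' * G x + F x * G')) x v := by
  unfold HasLineDerivAt at *
  have h : (fun t : ℝ => (fun y => c y * (F y * G y)) (x + t • v)) =
      fun t => c x * (F (x + t • v) * G (x + t • v)) := by
    funext t
    simp only [hc t]
  rw [h]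
  have hFG := hF.mul hG
  simp only [zero_smul, add_zero] at hFG
  exact hFG.const_mul (c x)

/-! ## B. The Liouville pairing is `μ_T`-antisymmetric (per site) -/

/-- **Antisymmetry of the site-`i` Liouville term under `e^{-H/T}`:** for `F, G ∈ C¹` with
`F, G, ∂_{q_i}F, ∂_{p_i}F, ∂_{q_i}G, ∂_{p_i}G` tempered,
`∫ G (p_i ∂_{q_i}F - ∂_{q_i}H ∂_{p_i}F) ρ_T = - ∫ (p_i ∂_{q_i}G - ∂_{q_i}H ∂_{p_i}G) F ρ_T`. -/
theorem integral_mul_liouville_mul_gibbsDensity_eq (hω : 0 < ω₂) (hl : 0 ≤ lam) (hβ : 0 ≤ β)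
    (γ : ℝ) {T : ℝ} (hT : 0 < T) (i : Fin N) {F G : PhaseSpace N → ℝ}
    (hF1 : ContDiff ℝ 1 F) (hG1 : ContDiff ℝ 1 G)
    (hF : IsTempered ω₂ lam β γ N F) (hG : IsTempered ω₂ lam β γ N G)
    (hFq : IsTempered ω₂ lam β γ N (partialQ i F)) (hFp : IsTempered ω₂ lam β γ N (partialP i F))
    (hGq : IsTempered ω₂ lam β γ N (partialQ i G)) (hGp : IsTempered ω₂ lam β γ N (partialP i G)) :
    ∫ x, G x * (x.2 i * partialQ i F x
        - partialQ i ((pinnedChain ω₂ lam β γ).hamiltonian N) x * partialP i F x)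
        * (pinnedChain ω₂ lam β γ).gibbsDensity N T x =
      -∫ x, (x.2 i * partialQ i G x
        - partialQ i ((pinnedChain ω₂ lam β γ).hamiltonian N) x * partialP i G x) * F x
        * (pinnedChain ω₂ lam β γ).gibbsDensity N T x := by
  have hFd := hF1.differentiable one_ne_zero; have hGd := hG1.differentiable one_ne_zero
  have hFc : Continuous F := hF1.continuous; have hGc : Continuous G := hG1.continuous
  have hFqc : Continuous (partialQ i F) := continuous_partialQ hF1 one_ne_zero i
  have hFpc : Continuous (partialP i F) := continuous_partialP hF1 one_ne_zero i
  have hGqc : Continuous (partialQ i G) := continuous_partialQ hG1 one_ne_zero i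
  have hGpc : Continuous (partialP i G) := continuous_partialP hG1 one_ne_zero i
  have hpc : Continuous fun x : PhaseSpace N => x.2 i := (continuous_apply i).comp continuous_snd
  have hHc : Continuous (partialQ i ((pinnedChain ω₂ lam β γ).hamiltonian N)) :=
    (pinnedChain ω₂ lam β γ).continuous_partialQ_hamiltonian
      (pinnedChain_contDiff_hamiltonian ω₂ lam β γ N) i
  have hp : IsTempered ω₂ lam β γ N (fun x : PhaseSpace N => x.2 i) := IsTempered.snd hω.le hl hβ i
  have hH : IsTempered ω₂ lam β γ N (partialQ i ((pinnedChain ω₂ lam β γ).hamiltonian N)) :=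
    IsTempered.partialQ_hamiltonian hω hl hβ i
  -- (IBP-q) on `p_i · G · F`
  have eQ := integral_partialQ_hamiltonian_mul_gibbsDensity_eq hω hl hβ γ hT i
    (F := fun x => x.2 i * (G x * F x))
    (F' := fun x => x.2 i * (partialQ i G x * F x + G x * partialQ i F x))
    (hpc.mul (hGc.mul hFc)) (hpc.mul ((hGqc.mul hFc).add (hGc.mul hFqc)))
    (fun x => hasLineDerivAt_mul_mul_of_invariant (fun t => by simp)
      (hasLineDerivAt_partialQ hGd i x) (hasLineDerivAt_partialQ hFd i x))
    (hp.mul (hG.mul hF)) (hp.mul ((hGq.mul hF).add hω.le hl hβ (hG.mul hFq)))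
  -- (IBP-p) on `∂_{q_i}H · G · F`
  have eP := integral_snd_mul_gibbsDensity_eq hω hl hβ γ hT i
    (F := fun x => partialQ i ((pinnedChain ω₂ lam β γ).hamiltonian N) x * (G x * F x))
    (F' := fun x => partialQ i ((pinnedChain ω₂ lam β γ).hamiltonian N) x *
      (partialP i G x * F x + G x * partialP i F x))
    (hHc.mul (hGc.mul hFc)) (hHc.mul ((hGpc.mul hFc).add (hGc.mul hFpc)))
    (fun x => hasLineDerivAt_mul_mul_of_invariant
      (fun t => (pinnedChain ω₂ lam β γ).partialQ_hamiltonian_add_smul_unitP N x i i t)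
      (hasLineDerivAt_partialP hGd i x) (hasLineDerivAt_partialP hFd i x))
    (hH.mul (hG.mul hF)) (hH.mul ((hGp.mul hF).add hω.le hl hβ (hG.mul hFp)))
  have hLHS : ∫ x, partialQ i ((pinnedChain ω₂ lam β γ).hamiltonian N) x * (x.2 i * (G x * F x)) *
      (pinnedChain ω₂ lam β γ).gibbsDensity N T x =
      ∫ x, x.2 i * (partialQ i ((pinnedChain ω₂ lam β γ).hamiltonian N) x * (G x * F x)) *
      (pinnedChain ω₂ lam β γ).gibbsDensity N T x := by
    refine integral_congr_ae (Filter.Eventually.of_forall fun x => ?_)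
    simp only
    ring
  have hAB : ∫ x, x.2 i * (partialQ i G x * F x + G x * partialQ i F x) *
      (pinnedChain ω₂ lam β γ).gibbsDensity N T x =
      ∫ x, partialQ i ((pinnedChain ω₂ lam β γ).hamiltonian N) x *
        (partialP i G x * F x + G x * partialP i F x) *
        (pinnedChain ω₂ lam β γ).gibbsDensity N T x :=
    mul_left_cancel₀ hT.ne' (eQ.symm.trans (hLHS.trans eP))
  have iA1 : Integrable fun x => x.2 i * (partialQ i G x * F x) *
      (pinnedChain ω₂ lam β γ).gibbsDensity N T x :=
    (hp.mul (hGq.mul hF)).integrable_mul_gibbsDensity (hpc.mul (hGqc.mul hFc)) hω hl hβ hT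
  have iA2 : Integrable fun x => x.2 i * (G x * partialQ i F x) *
      (pinnedChain ω₂ lam β γ).gibbsDensity N T x :=
    (hp.mul (hG.mul hFq)).integrable_mul_gibbsDensity (hpc.mul (hGc.mul hFqc)) hω hl hβ hT
  have iB1 : Integrable fun x => partialQ i ((pinnedChain ω₂ lam β γ).hamiltonian N) x *
      (partialP i G x * F x) * (pinnedChain ω₂ lam β γ).gibbsDensity N T x :=
    (hH.mul (hGp.mul hF)).integrable_mul_gibbsDensity (hHc.mul (hGpc.mul hFc)) hω hl hβ hT
  have iB2 : Integrable fun x => partialQ i ((pinnedChain ω₂ lam β γ).hamiltonian N) x *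
      (G x * partialP i F x) * (pinnedChain ω₂ lam β γ).gibbsDensity N T x :=
    (hH.mul (hG.mul hFp)).integrable_mul_gibbsDensity (hHc.mul (hGc.mul hFpc)) hω hl hβ hT
  have sA : ∫ x, x.2 i * (partialQ i G x * F x + G x * partialQ i F x) *
      (pinnedChain ω₂ lam β γ).gibbsDensity N T x =
      (∫ x, x.2 i * (partialQ i G x * F x) * (pinnedChain ω₂ lam β γ).gibbsDensity N T x) +
        ∫ x, x.2 i * (G x * partialQ i F x) * (pinnedChain ω₂ lam β γ).gibbsDensity N T x := by
    rw [← integral_add iA1 iA2]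
    refine integral_congr_ae (Filter.Eventually.of_forall fun x => ?_)
    ring
  have sB : ∫ x, partialQ i ((pinnedChain ω₂ lam β γ).hamiltonian N) x *
        (partialP i G x * F x + G x * partialP i F x) *
        (pinnedChain ω₂ lam β γ).gibbsDensity N T x =
      (∫ x, partialQ i ((pinnedChain ω₂ lam β γ).hamiltonian N) x * (partialP i G x * F x) *
          (pinnedChain ω₂ lam β γ).gibbsDensity N T x) +
        ∫ x, partialQ i ((pinnedChain ω₂ lam β γ).hamiltonian N) x * (G x * partialP i F x) *
          (pinnedChain ω₂ lam β γ).gibbsDensity N T x := by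
    rw [← integral_add iB1 iB2]
    refine integral_congr_ae (Filter.Eventually.of_forall fun x => ?_)
    ring
  have gL : ∫ x, G x * (x.2 i * partialQ i F x
        - partialQ i ((pinnedChain ω₂ lam β γ).hamiltonian N) x * partialP i F x)
        * (pinnedChain ω₂ lam β γ).gibbsDensity N T x =
      (∫ x, x.2 i * (G x * partialQ i F x) * (pinnedChain ω₂ lam β γ).gibbsDensity N T x) -
        ∫ x, partialQ i ((pinnedChain ω₂ lam β γ).hamiltonian N) x * (G x * partialP i F x) *
          (pinnedChain ω₂ lam β γ).gibbsDensity N T x := by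
    rw [← integral_sub iA2 iB2]
    refine integral_congr_ae (Filter.Eventually.of_forall fun x => ?_)
    ring
  have gR : ∫ x, (x.2 i * partialQ i G x
        - partialQ i ((pinnedChain ω₂ lam β γ).hamiltonian N) x * partialP i G x) * F x
        * (pinnedChain ω₂ lam β γ).gibbsDensity N T x =
      (∫ x, x.2 i * (partialQ i G x * F x) * (pinnedChain ω₂ lam β γ).gibbsDensity N T x) -
        ∫ x, partialQ i ((pinnedChain ω₂ lam β γ).hamiltonian N) x * (partialP i G x * F x) *
          (pinnedChain ω₂ lam β γ).gibbsDensity N T x := by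
    rw [← integral_sub iA1 iB1]
    refine integral_congr_ae (Filter.Eventually.of_forall fun x => ?_)
    ring
  rw [gL, gR]
  rw [sA, sB] at hAB
  linarith

/-! ## C. Each thermostat is `μ_T`-symmetric (per site) -/

/-- **The site-`c` Ornstein–Uhlenbeck term under `e^{-H/T}`:** for `F ∈ C²`, `G ∈ C¹` with
`G, ∂_{p_c}G, ∂_{p_c}F, ∂²_{p_c}F` tempered,
`∫ G (T ∂²_{p_c}F - p_c ∂_{p_c}F) ρ_T = -T ∫ ∂_{p_c}G ∂_{p_c}F ρ_T`. -/
theorem integral_mul_thermostat_mul_gibbsDensity_eq (hω : 0 < ω₂) (hl : 0 ≤ lam) (hβ : 0 ≤ β)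
    (γ : ℝ) {T : ℝ} (hT : 0 < T) (c : Fin N) {F G : PhaseSpace N → ℝ}
    (hF2 : ContDiff ℝ 2 F) (hG1 : ContDiff ℝ 1 G) (hG : IsTempered ω₂ lam β γ N G)
    (hGp : IsTempered ω₂ lam β γ N (partialP c G)) (hFp : IsTempered ω₂ lam β γ N (partialP c F))
    (hFpp : IsTempered ω₂ lam β γ N (partialP c (partialP c F))) :
    ∫ x, G x * (T * partialP c (partialP c F) x - x.2 c * partialP c F x) *
        (pinnedChain ω₂ lam β γ).gibbsDensity N T x =
      -(T * ∫ x, partialP c G x * partialP c F x *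
        (pinnedChain ω₂ lam β γ).gibbsDensity N T x) := by
  have hdF1 : ContDiff ℝ 1 (partialP c F) := contDiff_partialP hF2 (by norm_num) c
  have hGd := hG1.differentiable one_ne_zero; have hdFd := hdF1.differentiable one_ne_zero
  have hGc : Continuous G := hG1.continuous
  have hdFc : Continuous (partialP c F) := hdF1.continuous
  have hGpc : Continuous (partialP c G) := continuous_partialP hG1 one_ne_zero c
  have hddFc : Continuous (partialP c (partialP c F)) := continuous_partialP hdF1 one_ne_zero c
  have hpc : Continuous fun x : PhaseSpace N => x.2 c := (continuous_apply c).comp continuous_snd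
  have hp : IsTempered ω₂ lam β γ N (fun x : PhaseSpace N => x.2 c) := IsTempered.snd hω.le hl hβ c
  -- (IBP-p) on `G · ∂_{p_c}F`
  have e := integral_snd_mul_gibbsDensity_eq hω hl hβ γ hT c
    (F := fun x => G x * partialP c F x)
    (F' := fun x => partialP c G x * partialP c F x + G x * partialP c (partialP c F) x)
    (hGc.mul hdFc) ((hGpc.mul hdFc).add (hGc.mul hddFc))
    (fun x => by
      have h := hasLineDerivAt_mul_mul_of_invariant (c := fun _ : PhaseSpace N => (1 : ℝ))
        (fun _ => rfl) (hasLineDerivAt_partialP hGd c x) (hasLineDerivAt_partialP hdFd c x)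
      simp only [one_mul] at h
      exact h)
    (hG.mul hFp) ((hGp.mul hFp).add hω.le hl hβ (hG.mul hFpp))
  have i1 : Integrable fun x => partialP c G x * partialP c F x *
      (pinnedChain ω₂ lam β γ).gibbsDensity N T x :=
    (hGp.mul hFp).integrable_mul_gibbsDensity (hGpc.mul hdFc) hω hl hβ hT
  have i2 : Integrable fun x => G x * partialP c (partialP c F) x *
      (pinnedChain ω₂ lam β γ).gibbsDensity N T x :=
    (hG.mul hFpp).integrable_mul_gibbsDensity (hGc.mul hddFc) hω hl hβ hT
  have i3 : Integrable fun x => x.2 c * (G x * partialP c F x) *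
      (pinnedChain ω₂ lam β γ).gibbsDensity N T x :=
    (hp.mul (hG.mul hFp)).integrable_mul_gibbsDensity (hpc.mul (hGc.mul hdFc)) hω hl hβ hT
  have s : ∫ x, (partialP c G x * partialP c F x + G x * partialP c (partialP c F) x) *
      (pinnedChain ω₂ lam β γ).gibbsDensity N T x =
      (∫ x, partialP c G x * partialP c F x * (pinnedChain ω₂ lam β γ).gibbsDensity N T x) +
        ∫ x, G x * partialP c (partialP c F) x * (pinnedChain ω₂ lam β γ).gibbsDensity N T x := by
    rw [← integral_add i1 i2]
    refine integral_congr_ae (Filter.Eventually.of_forall fun x => ?_)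
    ring
  have gL : ∫ x, G x * (T * partialP c (partialP c F) x - x.2 c * partialP c F x) *
      (pinnedChain ω₂ lam β γ).gibbsDensity N T x =
      T * (∫ x, G x * partialP c (partialP c F) x * (pinnedChain ω₂ lam β γ).gibbsDensity N T x) -
        ∫ x, x.2 c * (G x * partialP c F x) * (pinnedChain ω₂ lam β γ).gibbsDensity N T x := by
    rw [← integral_const_mul, ← integral_sub (i2.const_mul T) i3]
    refine integral_congr_ae (Filter.Eventually.of_forall fun x => ?_)
    ring
  rw [gL, e, s]
  ring

/-! ## D. The adjoint identity -/

/-- Pointwise: the bath part of `L_{T,T}` is `γ Σ_i w_i (T ∂²_{p_i} - p_i ∂_{p_i})`,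
`w = bathWeight`. -/
theorem generator_eq_liouville_add_thermostat (P : OscillatorChain) (T : ℝ)
    (F : PhaseSpace N → ℝ) (x : PhaseSpace N) :
    P.generator N T T F x =
      (∑ i, (x.2 i * partialQ i F x - partialQ i (P.hamiltonian N) x * partialP i F x)) +
        P.γ * ∑ i, OscillatorChain.bathWeight N i *
          (T * partialP i (partialP i F) x - x.2 i * partialP i F x) := by
  unfold OscillatorChain.generator OscillatorChain.bathWeight
  congr 1
  congr 1
  refine Finset.sum_congr rfl fun i _ => ?_
  split_ifs <;> ring

/-- `Σ_i w_i (-(T J_i)) = -(T Σ_i w_i J_i)`. -/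
theorem sum_mul_neg_mul {ι : Type*} (s : Finset ι) (w J : ι → ℝ) (T : ℝ) :
    ∑ i ∈ s, w i * -(T * J i) = -(T * ∑ i ∈ s, w i * J i) := by
  rw [Finset.mul_sum, ← Finset.sum_neg_distrib]
  exact Finset.sum_congr rfl fun i _ => by ring

/-- **The `μ_T`-adjoint identity for `L_{T,T}` on the tempered class.** For `F ∈ C²`, `G ∈ C¹` with
`F, G, ∂_{q_i}F, ∂_{p_i}F, ∂²_{p_i}F, ∂_{q_i}G, ∂_{p_i}G` tempered (all `i`):
`∫ G (L F) ρ_T = - ∫ (X_H G) F ρ_T - γ T Σ_i w_i ∫ ∂_{p_i}G ∂_{p_i}F ρ_T`. -/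
theorem integral_mul_generator_mul_gibbsDensity_eq (hω : 0 < ω₂) (hl : 0 ≤ lam) (hβ : 0 ≤ β)
    (γ : ℝ) {T : ℝ} (hT : 0 < T) {F G : PhaseSpace N → ℝ}
    (hF2 : ContDiff ℝ 2 F) (hG1 : ContDiff ℝ 1 G)
    (hF : IsTempered ω₂ lam β γ N F) (hG : IsTempered ω₂ lam β γ N G)
    (hFq : ∀ i, IsTempered ω₂ lam β γ N (partialQ i F))
    (hFp : ∀ i, IsTempered ω₂ lam β γ N (partialP i F))
    (hFpp : ∀ i, IsTempered ω₂ lam β γ N (partialP i (partialP i F)))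
    (hGq : ∀ i, IsTempered ω₂ lam β γ N (partialQ i G))
    (hGp : ∀ i, IsTempered ω₂ lam β γ N (partialP i G)) :
    ∫ x, G x * (pinnedChain ω₂ lam β γ).generator N T T F x *
        (pinnedChain ω₂ lam β γ).gibbsDensity N T x =
      -(∫ x, (∑ i, (x.2 i * partialQ i G x
          - partialQ i ((pinnedChain ω₂ lam β γ).hamiltonian N) x * partialP i G x)) * F x *
          (pinnedChain ω₂ lam β γ).gibbsDensity N T x)
        - γ * T * ∑ i, OscillatorChain.bathWeight N i *
          ∫ x, partialP i G x * partialP i F x * (pinnedChain ω₂ lam β γ).gibbsDensity N T x := by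
  have hF1 : ContDiff ℝ 1 F := hF2.of_le (by norm_num)
  have hFc : Continuous F := hF1.continuous; have hGc : Continuous G := hG1.continuous
  have hpc : ∀ i, Continuous fun x : PhaseSpace N => x.2 i := fun i =>
    (continuous_apply i).comp continuous_snd
  have hHc : ∀ i, Continuous (partialQ i ((pinnedChain ω₂ lam β γ).hamiltonian N)) := fun i =>
    (pinnedChain ω₂ lam β γ).continuous_partialQ_hamiltonian
      (pinnedChain_contDiff_hamiltonian ω₂ lam β γ N) i
  have hp : ∀ i, IsTempered ω₂ lam β γ N (fun x : PhaseSpace N => x.2 i) := fun i =>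
    IsTempered.snd hω.le hl hβ i
  have hH : ∀ i, IsTempered ω₂ lam β γ N (partialQ i ((pinnedChain ω₂ lam β γ).hamiltonian N)) :=
    fun i => IsTempered.partialQ_hamiltonian hω hl hβ i
  have hγ : (pinnedChain ω₂ lam β γ).γ = γ := rfl
  -- integrability of the summands
  have iL : ∀ i, Integrable fun x => G x * (x.2 i * partialQ i F x
      - partialQ i ((pinnedChain ω₂ lam β γ).hamiltonian N) x * partialP i F x) *
      (pinnedChain ω₂ lam β γ).gibbsDensity N T x := fun i =>
    (hG.mul (((hp i).mul (hFq i)).sub hω.le hl hβ ((hH i).mul (hFp i)))).integrable_mul_gibbsDensity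
      (hGc.mul (((hpc i).mul (continuous_partialQ hF1 one_ne_zero i)).sub
        ((hHc i).mul (continuous_partialP hF1 one_ne_zero i)))) hω hl hβ hT
  have iB : ∀ i, Integrable fun x => OscillatorChain.bathWeight N i *
      (G x * (T * partialP i (partialP i F) x - x.2 i * partialP i F x) *
        (pinnedChain ω₂ lam β γ).gibbsDensity N T x) := fun i =>
    ((hG.mul (((hFpp i).const_mul T).sub hω.le hl hβ
        ((hp i).mul (hFp i)))).integrable_mul_gibbsDensity
      (hGc.mul ((continuous_const.mul (continuous_partialP (contDiff_partialP hF2 (by norm_num) i)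
        one_ne_zero i)).sub ((hpc i).mul (continuous_partialP hF1 one_ne_zero i))))
          hω hl hβ hT).const_mul _
  have iX : ∀ i, Integrable fun x => (x.2 i * partialQ i G x
      - partialQ i ((pinnedChain ω₂ lam β γ).hamiltonian N) x * partialP i G x) * F x *
      (pinnedChain ω₂ lam β γ).gibbsDensity N T x := fun i =>
    ((((hp i).mul (hGq i)).sub hω.le hl hβ ((hH i).mul (hGp i))).mul hF).integrable_mul_gibbsDensity
      (((((hpc i).mul (continuous_partialQ hG1 one_ne_zero i)).sub
        ((hHc i).mul (continuous_partialP hG1 one_ne_zero i)))).mul hFc) hω hl hβ hT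
  -- split the left-hand side
  have hpt : ∀ x, G x * (pinnedChain ω₂ lam β γ).generator N T T F x *
      (pinnedChain ω₂ lam β γ).gibbsDensity N T x =
      (∑ i, G x * (x.2 i * partialQ i F x
          - partialQ i ((pinnedChain ω₂ lam β γ).hamiltonian N) x * partialP i F x) *
          (pinnedChain ω₂ lam β γ).gibbsDensity N T x) +
        γ * ∑ i, OscillatorChain.bathWeight N i *
          (G x * (T * partialP i (partialP i F) x - x.2 i * partialP i F x) *
            (pinnedChain ω₂ lam β γ).gibbsDensity N T x) := by
    intro x
    rw [generator_eq_liouville_add_thermostat, hγ, mul_add, add_mul, Finset.mul_sum, Finset.sum_mul,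
      Finset.mul_sum, Finset.mul_sum, Finset.sum_mul, Finset.mul_sum]
    congr 1
    refine Finset.sum_congr rfl fun i _ => ?_
    ring
  have hL : ∫ x, G x * (pinnedChain ω₂ lam β γ).generator N T T F x *
      (pinnedChain ω₂ lam β γ).gibbsDensity N T x =
      (∑ i, ∫ x, G x * (x.2 i * partialQ i F x
          - partialQ i ((pinnedChain ω₂ lam β γ).hamiltonian N) x * partialP i F x) *
          (pinnedChain ω₂ lam β γ).gibbsDensity N T x) +
        γ * ∑ i, OscillatorChain.bathWeight N i *
          ∫ x, G x * (T * partialP i (partialP i F) x - x.2 i * partialP i F x) *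
            (pinnedChain ω₂ lam β γ).gibbsDensity N T x := by
    rw [integral_congr_ae (Filter.Eventually.of_forall hpt),
      integral_add (integrable_finsetSum _ fun i _ => iL i)
        ((integrable_finsetSum _ fun i _ => iB i).const_mul γ),
      integral_finsetSum _ fun i _ => iL i, integral_const_mul,
      integral_finsetSum _ fun i _ => iB i]
    congr 2
    refine Finset.sum_congr rfl fun i _ => ?_
    exact integral_const_mul _ _
  -- split the right-hand side
  have hR : ∫ x, (∑ i, (x.2 i * partialQ i G x
          - partialQ i ((pinnedChain ω₂ lam β γ).hamiltonian N) x * partialP i G x)) * F x *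
          (pinnedChain ω₂ lam β γ).gibbsDensity N T x =
      ∑ i, ∫ x, (x.2 i * partialQ i G x
          - partialQ i ((pinnedChain ω₂ lam β γ).hamiltonian N) x * partialP i G x) * F x *
          (pinnedChain ω₂ lam β γ).gibbsDensity N T x := by
    rw [← integral_finsetSum _ fun i _ => iX i]
    refine integral_congr_ae (Filter.Eventually.of_forall fun x => ?_)
    simp only [Finset.sum_mul]
  have hbath : ∀ i ∈ (Finset.univ : Finset (Fin N)), OscillatorChain.bathWeight N i *
      ∫ x, G x * (T * partialP i (partialP i F) x - x.2 i * partialP i F x) *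
        (pinnedChain ω₂ lam β γ).gibbsDensity N T x =
      OscillatorChain.bathWeight N i * -(T * ∫ x, partialP i G x * partialP i F x *
        (pinnedChain ω₂ lam β γ).gibbsDensity N T x) := fun i _ => by
    rw [integral_mul_thermostat_mul_gibbsDensity_eq hω hl hβ γ hT i hF2 hG1 hG (hGp i) (hFp i)
      (hFpp i)]
  rw [hL, hR, Finset.sum_congr rfl fun i _ =>
      integral_mul_liouville_mul_gibbsDensity_eq hω hl hβ γ hT i hF1 hG1 hF hG (hFq i) (hFp i)
        (hGq i) (hGp i), Finset.sum_congr rfl hbath, Finset.sum_neg_distrib, sum_mul_neg_mul]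
  ring

/-! ## E. Corollary: `G = p_b` -/

/-- **(ADJ-p)** For `F ∈ C²` with `F, ∂F, ∂²_{p_i}F` tempered:
`∫ p_b (L F) ρ_T = ∫ ∂_{q_b}H F ρ_T - γ w_b ∫ p_b F ρ_T` (`X_H p_b = -∂_{q_b}H`,
`∂_{p_i} p_b = δ_{ib}`, and (IBP-p) `T ∫ ∂_{p_b}F ρ_T = ∫ p_b F ρ_T`). -/
theorem integral_snd_mul_generator_mul_gibbsDensity_eq (hω : 0 < ω₂) (hl : 0 ≤ lam) (hβ : 0 ≤ β)
    (γ : ℝ) {T : ℝ} (hT : 0 < T) (b : Fin N) {F : PhaseSpace N → ℝ} (hF2 : ContDiff ℝ 2 F)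
    (hF : IsTempered ω₂ lam β γ N F) (hFq : ∀ i, IsTempered ω₂ lam β γ N (partialQ i F))
    (hFp : ∀ i, IsTempered ω₂ lam β γ N (partialP i F))
    (hFpp : ∀ i, IsTempered ω₂ lam β γ N (partialP i (partialP i F))) :
    ∫ x, x.2 b * (pinnedChain ω₂ lam β γ).generator N T T F x *
        (pinnedChain ω₂ lam β γ).gibbsDensity N T x =
      (∫ x, partialQ b ((pinnedChain ω₂ lam β γ).hamiltonian N) x * F x *
          (pinnedChain ω₂ lam β γ).gibbsDensity N T x)
        - γ * OscillatorChain.bathWeight N b *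
          ∫ x, x.2 b * F x * (pinnedChain ω₂ lam β γ).gibbsDensity N T x := by
  classical
  have hF1 : ContDiff ℝ 1 F := hF2.of_le (by norm_num)
  have hG1 : ContDiff ℝ 1 (fun y : PhaseSpace N => y.2 b) :=
    (contDiff_apply ℝ ℝ b).comp contDiff_snd
  have hGq : ∀ i, partialQ i (fun y : PhaseSpace N => y.2 b) = fun _ => 0 := fun i =>
    funext fun z => partialQ_snd i b z
  have hGp : ∀ i, partialP i (fun y : PhaseSpace N => y.2 b) =
      fun _ => if b = i then (1 : ℝ) else 0 := fun i => funext fun z => partialP_snd i b z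
  have h := integral_mul_generator_mul_gibbsDensity_eq hω hl hβ γ hT hF2 hG1 hF
    (IsTempered.snd hω.le hl hβ b) hFq hFp hFpp
    (fun i => by rw [hGq i]; exact IsTempered.const 0)
    (fun i => by rw [hGp i]; exact IsTempered.const _)
  rw [h]
  simp only [hGq, hGp, mul_zero, zero_sub, mul_ite, mul_one, ite_mul, one_mul, zero_mul]
  have hsum : ∀ x : PhaseSpace N,
      (∑ i, -(if b = i then partialQ i ((pinnedChain ω₂ lam β γ).hamiltonian N) x else 0)) =
        -partialQ b ((pinnedChain ω₂ lam β γ).hamiltonian N) x := fun x => by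
    rw [Finset.sum_neg_distrib, Finset.sum_ite_eq]
    simp
  simp only [hsum]
  rw [Finset.sum_eq_single b (fun i _ hib => by simp [Ne.symm hib]) (by simp)]
  simp only [if_true]
  rw [integral_snd_mul_gibbsDensity_eq_partialP hω hl hβ γ hT b hF1 hF (hFp b)]
  simp only [neg_mul, integral_neg, neg_neg]
  ring

end EscapeGrading

end Summit.AtomisticToContinuum.FouriersLaw.Theorems.SubdiffusiveBondHeat
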